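import Summits.QuantumFields.BalabanUV.Beta.LagrangeFoldStep

/-!
# `BalabanUV.Beta.LagrangeFoldZero` — binder row D1, (L4) bookkeeping: the Λ-fold at LEVEL 0 (`BalabanStepJets.lamCoeffOf` against the rooted
# bordered Hessian `bhKAt`): «ORDER-ONE CONSISTENCY» of the Λ-sector of `S0NAt`-type tables, for the slot typed through the wall's `G_0`
# (β sub-cell, D1 formalisation swarm, unit `b2b-balaban-beta-d1-formalise-leaf-10`, gen 2; CLAIM «D1-L4-FOLD», part 3)

NOT IN PRINT; OUR BOOKKEEPING.  HONEST FRAMING (cell contract, verbatim): «discharging `BetaPertH` makes Bałaban's UV stability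
UNCONDITIONAL — a real constructive-QFT result; it is NOT the continuum limit and NOT the Clay problem.»  HONEST DEPENDENCY (verbatim):
«continuum YM on T⁴ ⇐ BetaPertH ∧ nine spine estimates (0/9 proved); BetaPertH ⇐ (D1) ∧ (D4) ∧ CAP+tail; G-an2-4 gates asym, D1 and
NE2/3/4.»  [folklore] kernel algebra; instantiates NO binder of the β-function wall; no `[cite:]`, no `def`, no `def … : Prop`; NOT D1,
NOT `BetaPertH`, NOT continuum, NOT Clay.

## What

Level `0` of the recursive first-order tables (`SpineRootedS0N.S0NAt`) types its Lagrange piece with the FINITE-RANGE coefficients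
`BalabanStepJets.lamCoeffOf A N μ y κ′ u = Σ_{v ∈ box1} Σ_α A (N•y) (u+v) (inr μ) (inl α) · elCol κ′ u α (u+v)` (the flat Wilson-Hessian column)
instead of `lamCoeffK A E N`.  §1 `lamCoeffOf_eq_lamCoeffK`: these ARE `lamCoeffK A H₀ N` for `H₀` = the field block of the rooted
bordered Hessian `bhKAt d ρ N` (the windowed `d*d`, window `|z − x|_∞ ≤ 2` ⊇ the column's support `box1`; `elCol κ′ u = curvAdj (curv (delta1 κ′ u))`
by `rfl`).  §2 then runs parts 1–2 at `j = 0` (`bhKStepAt 0 = bhKAt`, `RelInv` from `relInv_coDressKBmAt_KInvStep_bhKStepAt_all hr 0`):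
**`vertexOfK_lagrangePiece_zero_eq_vertexOfM`**: for `G₀ := coDressKBmAt (toSite r) N (KInvStep N 0)` and any bounded coarse-bond table `Q`,
`vertexOfK G₀ N (κ u ↦ c • SLam N (lamCoeffOf G₀ N) Q κ u) μ y = c • vertexOfM G₀ N Q μ y` (weight `c`, sign PLUS — at level 0 the field
block of the step operator carries no `wVH` factor), and **`vertexOfK_lagrangePiece_zero_eq_M1At`**: with `c := cΛ`, `Q := hessFFAt (toSite r) N`
this is literally `vertexOfM G₀ N (M1At d N (toSite r) cΛ 0)` (`wM1 0 = 1`).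

NOT CLAIMED: the same for `S0NAt`'s ACTUAL slot `lamCoeffOf (KInv N) N` (STRAIGHT `KInv` coefficients read through the co-dressed `G₀` — the
mixed sandwich `KInv∘H₀∘G₀`; an2's OPEN TYPING POINT (Λ-slot), level 0); anything about (W-L4)'s table laws.
-/

noncomputable section

open Finset
open scoped BigOperators
open Literature.MathematicalPhysics.QuantumFieldTheory
open Literature.MathematicalPhysics.QuantumFieldTheory.Balaban1983to89
open Literature.MathematicalPhysics.QuantumFieldTheory.Balaban1983to89.Beta
open B12Sec2to5 (l1 l1_nonneg)
open ExpKernelCalculus (MKer Decays comp)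
open KernelWard (bdd_of_decays)
open AffineAveraging (box toSite curv curvAdj)
open OneStepResolventKernel (Fib decays_mono)
open OneStepKernelFamily (KInvStep vertexOfK)
open InterLevelTransport (SLam cwsum cwsum_apply)
open BalabanStepJets (lamCoeffOf elCol box1 mem_box1 elCol_eq_zero_of_not_mem_box1)
open BalabanStepJetsSucc (lamCoeffK decays_comp)
open BalabanStepW2 (wM1)
open SecondOrderResponse (colM vertexOfM)
open AveragingHessianKernelsRooted (hessFFAt)
open Summit.QuantumFields.BalabanUV.Beta.TameKernelCalculus
open Summit.QuantumFields.BalabanUV.Beta.AxialDressingRooted (cube mem_cube axEc coDressKBmAt decays_coDressKBmAt_KInvStep one_le_of_neZero)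
open Summit.QuantumFields.BalabanUV.Beta.BorderedHessian (bhKAt bhKStepAt bhKStepAt_zero decays_bhKAt)
open Summit.QuantumFields.BalabanUV.Beta.SpineRooted (M1At relInv_coDressKBmAt_KInvStep_bhKStepAt_all)
open Summit.QuantumFields.BalabanUV.Beta.LagrangeFold (vertexOfK_smul_SLam_lamCoeffK)
open Summit.QuantumFields.BalabanUV.Beta.LagrangeFoldStep (mm_sandwich_eq_neg)

namespace Summit.QuantumFields.BalabanUV.Beta.LagrangeFoldZero

variable {d : ℕ} {N : ℕ}

/-! ## §1 The finite-range coefficients are `lamCoeffK` against the field block of `bhKAt` -/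

/-- [folklore] Offsets in `box1` lie in the `bhKAt` window: `v ∈ box1 ⇒ −v ∈ cube 2`. -/
theorem neg_mem_cube_two_of_mem_box1 {v : Fin (d + 1) → ℤ} (hv : v ∈ box1 (d + 1)) : -v ∈ cube (d + 1) 2 := by
  rw [mem_cube]
  rw [mem_box1] at hv
  intro i
  rcases hv i with h | h | h <;> simp [h]

/-- [folklore] **THE LEVEL-0 COEFFICIENTS ARE `lamCoeffK` AGAINST THE FIELD BLOCK OF THE ROOTED BORDERED HESSIAN**: for any kernel
`H₀` whose field block is that of `bhKAt d ρ N` and whose multiplier rows of field columns vanish,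
`lamCoeffOf A N μ y κ′ u = lamCoeffK A H₀ N μ y κ′ u` (the `bhKAt` window `|z − x|_∞ ≤ 2` contains the support `box1` of the flat
Wilson-Hessian column; `elCol κ′ u = curvAdj (curv (delta1 κ′ u))` definitionally). -/
theorem lamCoeffOf_eq_lamCoeffK (ρ : Fin (d + 1) → ℤ) (A H₀ : MKer (d + 1) (Fib d))
    (hff : ∀ x z κ l, H₀ x z (Sum.inl κ) (Sum.inl l) = bhKAt d ρ N x z (Sum.inl κ) (Sum.inl l))
    (hmf : ∀ x z ν l, H₀ x z (Sum.inr ν) (Sum.inl l) = 0) (μ : Fin (d + 1)) (y : Fin (d + 1) → ℤ) (κ' : Fin (d + 1))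
    (u : Fin (d + 1) → ℤ) : lamCoeffOf A N μ y κ' u = lamCoeffK A H₀ N μ y κ' u := by
  classical
  unfold lamCoeffK ExpKernelCalculus.comp lamCoeffOf
  -- the field block of `bhKAt`, as the windowed flat Wilson-Hessian column
  have hb : ∀ w α, bhKAt d ρ N w u (Sum.inl α) (Sum.inl κ') = if u - w ∈ cube (d + 1) 2 then elCol κ' u α w else 0 :=
    fun w α => rfl
  -- the summand of the right-hand side
  set g : (Fin (d + 1) → ℤ) → ℝ := fun w => ∑ α : Fin (d + 1), A ((N : ℤ) • y) w (Sum.inr μ) (Sum.inl α) *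
      (if u - w ∈ cube (d + 1) 2 then elCol κ' u α w else 0) with hg
  have e1 : (fun w => ∑ f : Fib d, A ((N : ℤ) • y) w (Sum.inr μ) f * H₀ w u f (Sum.inl κ')) = g := by
    funext w
    rw [Fintype.sum_sum_type]
    simp only [hff, hmf, hb, mul_zero, Finset.sum_const_zero, add_zero, hg]
  rw [e1]
  -- `g` is supported on `u + box1`
  have hsupp : ∀ w ∉ (box1 (d + 1)).image (fun v => u + v), g w = 0 := by
    intro w hw
    have hv : w - u ∉ box1 (d + 1) := fun h => hw (Finset.mem_image.mpr ⟨w - u, h, by abel⟩)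
    simp only [hg]
    refine Finset.sum_eq_zero fun α _ => ?_
    have h0 : elCol κ' u α w = 0 := by
      have := elCol_eq_zero_of_not_mem_box1 (κ' := κ') (u := u) (α := α) hv
      rwa [add_sub_cancel] at this
    simp only [h0, ite_self, mul_zero]
  symm
  rw [tsum_eq_sum hsupp, Finset.sum_image (fun v _ v' _ h => add_left_cancel h)]
  refine Finset.sum_congr rfl fun v hv => Finset.sum_congr rfl fun α _ => ?_
  rw [show u - (u + v) = -v by abel, if_pos (neg_mem_cube_two_of_mem_box1 hv)]

/-! ## §2 Level 0 of the wall: `G₀ := coDressKBmAt (toSite r) N (KInvStep N 0)` against `bhKStepAt 0 = bhKAt` -/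

section Wall

variable [NeZero N] {r : Fin (d + 1) → ℕ}

omit [NeZero N] in
/-- [folklore] `wM1 0 = 1`. -/
theorem wM1_zero : wM1 d N 0 = 1 := by simp [wM1]

/-- [folklore] **THE MULTIPLIER COLUMN OF THE LEVEL-0 SANDWICH**: `colM (G₀∘H₀∘G₀) N μ y ρ′ w = −colM G₀ N μ y ρ′ w` (part 2 §1 at `j = 0`). -/
theorem colM_sandwich_zero (hr : r ∈ box (d + 1) N) (μ : Fin (d + 1)) (y : Fin (d + 1) → ℤ) (ρ' : Fin (d + 1)) (w : Fin (d + 1) → ℤ) :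
    colM (comp (comp (coDressKBmAt (toSite r) N (KInvStep (d := d) N 0))
        (fun x z a b => match a, b with
          | Sum.inl κ, Sum.inl l => bhKAt d (toSite r) N x z (Sum.inl κ) (Sum.inl l)
          | _, _ => 0))
        (coDressKBmAt (toSite r) N (KInvStep (d := d) N 0))) N μ y ρ' w
      = -colM (coDressKBmAt (toSite r) N (KInvStep (d := d) N 0)) N μ y ρ' w := by
  have hN : 1 ≤ N := one_le_of_neZero N
  have hMd : Decays (bhKAt d (toSite r) N) _ 0 := decays_bhKAt (d := d) hN hr le_rfl
  set H₀ : MKer (d + 1) (Fib d) := fun x z a b => match a, b with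
    | Sum.inl κ, Sum.inl l => bhKAt d (toSite r) N x z (Sum.inl κ) (Sum.inl l)
    | _, _ => 0 with hH
  have hMmm : ∀ x z (ν ν' : Fin (d + 1)), bhKStepAt d (toSite r) N 0 x z (Sum.inr ν) (Sum.inr ν') = 0 := fun x z ν ν' => by
    rw [bhKStepAt_zero]; rfl
  have hHff : ∀ x z (κ l : Fin (d + 1)), H₀ x z (Sum.inl κ) (Sum.inl l) = bhKStepAt d (toSite r) N 0 x z (Sum.inl κ) (Sum.inl l) :=
    fun x z κ l => by rw [bhKStepAt_zero]
  have hHfm : ∀ x z (κ ν : Fin (d + 1)), H₀ x z (Sum.inl κ) (Sum.inr ν) = 0 := fun x z κ ν => rfl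
  have hHmf : ∀ x z (ν l : Fin (d + 1)), H₀ x z (Sum.inr ν) (Sum.inl l) = 0 := fun x z ν l => rfl
  have hHmm : ∀ x z (ν ν' : Fin (d + 1)), H₀ x z (Sum.inr ν) (Sum.inr ν') = 0 := fun x z ν ν' => rfl
  have hMb : ∃ B : ℝ, ∀ x z a b, |bhKStepAt d (toSite r) N 0 x z a b| ≤ B :=
    ⟨_, fun x z a b => by rw [bhKStepAt_zero]; exact bdd_of_decays hMd le_rfl x z a b⟩
  simp only [colM]
  exact mm_sandwich_eq_neg (relInv_coDressKBmAt_KInvStep_bhKStepAt_all hr 0) (decays_coDressKBmAt_KInvStep hr 0) hMb hMmm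
    hHff hHfm hHmf hHmm _ _ ρ' μ

/-- [folklore] **THE LEVEL-0 Λ-FOLD, TYPED THROUGH `G₀`, IS THE MULTIPLIER-COLUMN VERTEX**:
`vertexOfK G₀ N (κ u ↦ c • SLam N (lamCoeffOf G₀ N) Q κ u) μ y = c • vertexOfM G₀ N Q μ y` for every bounded coarse-bond table `Q`
(weight `c`, sign PLUS). -/
theorem vertexOfK_lagrangePiece_zero_eq_vertexOfM (hr : r ∈ box (d + 1) N)
    {Q : Fin (d + 1) → (Fin (d + 1) → ℤ) → MKer (d + 1) (Fib d)} {B : ℝ} (hQ : ∀ ρ' w x z a b, |Q ρ' w x z a b| ≤ B) (c : ℝ)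
    (μ : Fin (d + 1)) (y : Fin (d + 1) → ℤ) :
    vertexOfK (coDressKBmAt (toSite r) N (KInvStep (d := d) N 0)) N
        (fun κ u => c • SLam N (lamCoeffOf (coDressKBmAt (toSite r) N (KInvStep (d := d) N 0)) N) Q κ u) μ y
      = c • vertexOfM (coDressKBmAt (toSite r) N (KInvStep (d := d) N 0)) N Q μ y := by
  have hN : 1 ≤ N := one_le_of_neZero N
  set G := coDressKBmAt (toSite r) N (KInvStep (d := d) N 0) with hGdef
  set H₀ : MKer (d + 1) (Fib d) := fun x z a b => match a, b with
    | Sum.inl κ, Sum.inl l => bhKAt d (toSite r) N x z (Sum.inl κ) (Sum.inl l)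
    | _, _ => 0 with hH
  have hcoef : lamCoeffOf G N = lamCoeffK G H₀ N := by
    funext μ' y' κ' u'
    exact lamCoeffOf_eq_lamCoeffK (toSite r) G H₀ (fun x z κ l => rfl) (fun x z ν l => rfl) μ' y' κ' u'
  have hG := decays_coDressKBmAt_KInvStep (d := d) hr 0
  -- `H₀` decays (entries dominated by those of `bhKAt`)
  have hH₀ : ∃ δ C : ℝ, 0 < δ ∧ 0 ≤ C ∧ Decays H₀ C δ := by
    have hMd := decays_bhKAt (d := d) hN hr (show (0 : ℝ) ≤ 1 from zero_le_one)
    refine ⟨1, _, one_pos, hMd.nonneg (Sum.inl 0), fun x z a b => ?_⟩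
    rcases a with κ | ν <;> rcases b with l | ν'
    · exact hMd x z (Sum.inl κ) (Sum.inl l)
    all_goals
      simp only [hH, abs_zero]
      exact (abs_nonneg _).trans (hMd x z (Sum.inl 0) (Sum.inl 0))
  have hAE : ∃ δ C : ℝ, 0 < δ ∧ 0 ≤ C ∧ Decays (comp G H₀) C δ := by
    obtain ⟨δ₁, C₁, hδ₁, hC₁, h₁⟩ := hG
    obtain ⟨δ₂, C₂, hδ₂, hC₂, h₂⟩ := hH₀
    have h₁' : Decays G C₁ (min δ₁ δ₂) := decays_mono h₁ hC₁ le_rfl (min_le_left _ _)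
    have h₂' : Decays H₀ C₂ (min δ₁ δ₂) := decays_mono h₂ hC₂ le_rfl (min_le_right _ _)
    have hm : 0 < min δ₁ δ₂ := lt_min hδ₁ hδ₂
    exact ⟨min δ₁ δ₂ / 2, _, half_pos hm, (decays_comp h₁' h₂' (half_pos hm).le (half_lt_self hm)).nonneg (Sum.inl 0),
      decays_comp h₁' h₂' (half_pos hm).le (half_lt_self hm)⟩
  have hE : ∀ v u (h : Fib d) (ν : Fin (d + 1)), H₀ v u h (Sum.inr ν) = 0 := fun v u h ν => by cases h <;> rfl
  rw [hcoef, vertexOfK_smul_SLam_lamCoeffK (N := N) hG hAE hE hQ c μ y]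
  -- the sandwich's multiplier-column vertex is minus that of `G`
  have hv : vertexOfM (comp (comp G H₀) G) N Q μ y = -vertexOfM G N Q μ y := by
    funext x z a b
    simp only [vertexOfM, cwsum_apply, Pi.neg_apply, ← Finset.sum_neg_distrib, ← tsum_neg]
    refine Finset.sum_congr rfl fun ρ' _ => tsum_congr fun w => ?_
    rw [hGdef, hH, colM_sandwich_zero hr μ y ρ' w, ← hGdef]
    ring
  rw [hv, smul_neg, neg_neg]

/-- [folklore] **ORDER-ONE CONSISTENCY OF THE Λ-SECTOR AT LEVEL 0, LITERALLY**: with weight `cΛ` and `Q := hessFFAt (toSite r) N` (given any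
uniform entry bound), the level-0 Lagrange piece with coefficients typed THROUGH `G₀`, read through the field rows of `G₀`, IS
`vertexOfM G₀ N (M1At d N (toSite r) cΛ 0)` (`wM1 0 = 1`). -/
theorem vertexOfK_lagrangePiece_zero_eq_M1At (hr : r ∈ box (d + 1) N) (cΛ : ℝ) {B : ℝ}
    (hQ : ∀ ρ' w x z a b, |hessFFAt (toSite r) N ρ' w x z a b| ≤ B) (μ : Fin (d + 1)) (y : Fin (d + 1) → ℤ) :
    vertexOfK (coDressKBmAt (toSite r) N (KInvStep (d := d) N 0)) N
        (fun κ u => cΛ • SLam N (lamCoeffOf (coDressKBmAt (toSite r) N (KInvStep (d := d) N 0)) N) (hessFFAt (toSite r) N) κ u) μ y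
      = vertexOfM (coDressKBmAt (toSite r) N (KInvStep (d := d) N 0)) N (M1At d N (toSite r) cΛ 0) μ y := by
  rw [vertexOfK_lagrangePiece_zero_eq_vertexOfM hr hQ cΛ μ y]
  funext x z a b
  simp only [Pi.smul_apply, smul_eq_mul, vertexOfM, cwsum_apply, M1At, wM1_zero, mul_one, Finset.mul_sum]
  refine Finset.sum_congr rfl fun ρ' _ => ?_
  rw [← tsum_mul_left]
  exact tsum_congr fun w => by ring

end Wall

end Summit.QuantumFields.BalabanUV.Beta.LagrangeFoldZero

end
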